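import Literature.Topology.FourManifolds.DiscTheoremCorners
import HarnessLib

/-!
# The disc theorem without orientation hypotheses (up to a reflection)

Topic `Literature/Topology/FourManifolds`. The tree proves the **oriented** disc theorem of
Palais–Cerf (R. Palais, *Extending diffeomorphisms*, Proc. AMS 11 (1960), Thm. B; J. Cerf (1961);
M. W. Hirsch, *Differential Topology* (1976), Ch. 8 §3, Thm. 3.1) for manifolds modelled on `ℝⁿ`
with compact support (`DiscTheoremSupport.lean`,
`Literature.Topology.FourManifolds.exists_diffeomorph_apply_disc_eq_cs`) and for arbitrary real
models with corners (`DiscTheoremCorners.lean`,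
`Literature.Topology.FourManifolds.exists_diffeomorph_apply_disc_eq_of_model`): two discs which
both preserve a pair of orientations `(o₀, oM)` agree on the unit ball after a diffeomorphism.
Those statements presuppose a global smooth orientation `oM` of `M`.

This file proves the **unoriented** forms, valid in every connected manifold, orientable or not
(Hirsch, *loc. cit.*, Thm. 3.1 together with the remark following it; Kosinski, *Differential
Manifolds* (1993), Ch. III, Thm. (3.6): in a connected `M` any two embeddings of `Dᵐ` in `Int M`
are ambient isotopic up to precomposition with a reflection `r`): for two discs `i, i'` in a
connected Hausdorff manifold and ANY fixed linear automorphism `r` of the model vector space of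
negative determinant there is a diffeomorphism `f` of `M` with EITHER `f (i y) = i' y` for all
`‖y‖ ≤ 1` OR `f (i (r y)) = i' y` for all `‖y‖ ≤ 1`:

* `Literature.Topology.FourManifolds.exists_diffeomorph_apply_disc_eq_or_reflect_cs` — manifolds
  modelled on `ℝⁿ`, `f` with compact (fixed) support;
* `Literature.Topology.FourManifolds.exists_diffeomorph_apply_disc_eq_or_reflect_of_model` —
  arbitrary real model with corners over a finite-dimensional `E ≠ 0` (boundary allowed, discs
  are automatically interior).

## Proof

The `ℝⁿ` case is the tree's proof of the oriented theorem verbatim (move the centre by compactly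
supported homogeneity; in the chart `Φ = (i')⁻¹` straighten the local map `F = Φ ∘ f₁ ∘ i`;
shrink both discs), except at the one place where the orientations were used — to know that
`det DF(0) > 0`. Here `det DF(0) ≠ 0` because `F` is a local diffeomorphism
(`Literature.Topology.FourManifolds.det_fderiv_chart_comp_disc_ne_zero`), and if it is negative
the disc `f₁ ∘ i` is replaced by `f₁ ∘ i ∘ r`, whose local map `F ∘ r` has positive
determinant. No orientation, orientability or orientation-character dichotomy is needed. The
local straightening step shared by both cases is
`Literature.Topology.FourManifolds.exists_diffeomorph_apply_disc_eq_local_cs_of_det_pos`.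
The general-model case is verbatim the reduction of `DiscTheoremCorners.lean` — interior
manifold (`InteriorDiscs.lean`), recharting on `ℝⁿ` along a norm-non-increasing `L : E ≃L ℝⁿ`
(`Recharted.lean`), the compactly supported theorem on `ℝⁿ` for the conjugated reflection
`L ∘ r ∘ L⁻¹` (same determinant), extension by the identity (`InteriorDiffeoExtension.lean`).

These theorems are the input of the uniqueness of connected sums with an amphichiral summand
without orientation conventions (`ConnectedSumAmphichiralUniqueness.lean`).

## References

* R. Palais, *Extending diffeomorphisms*, Proc. AMS 11 (1960) 274–277, Thm. B. [Palais1960]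
* M. W. Hirsch, *Differential Topology*, GTM 33 (1976), Ch. 8 §3, Thm. 3.1. [HirschDT1976]
* A. Kosinski, *Differential Manifolds* (1993), Ch. III Thm. (3.6), Ch. VI §1 Thm. (1.1).
  [Kosinski1993]
-/

open scoped Manifold ContDiff Topology
open Set Module Function Filter OpenPartialHomeomorph Metric

noncomputable section

namespace Literature.Topology.FourManifolds

section Euclidean

variable {n : ℕ}

variable {M : Type*} [TopologicalSpace M] [T2Space M] [ChartedSpace (EuclideanSpace ℝ (Fin n)) M]
  [IsManifold (𝓡 n) ∞ M]

/-! ### The local map of a disc in a full chart is a local diffeomorphism -/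

omit [T2Space M] [IsManifold (𝓡 n) ∞ M] in
/-- **The Jacobian of a disc read in a full smooth chart is invertible.** If `k : ℝⁿ → M` is a
disc (a smooth embedding of the model space), `Φ` a smooth chart of `M` onto `ℝⁿ` with smooth
inverse and `k 0 ∈ Φ.source`, then `det D(Φ ∘ k)(0) ≠ 0`: both `dk(0)` (an equidimensional
embedding, `det_mfderiv_ne_zero_of_isSmoothEmbedding`) and `dΦ(k 0)` (a chart, `Φ ∘ Φ⁻¹ = id`)
are invertible (Lee, *Introduction to Smooth Manifolds* (2013), Prop. 4.8; Hirsch (1976), §1.3).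
[folklore] -/
theorem det_fderiv_chart_comp_disc_ne_zero {k : EuclideanSpace ℝ (Fin n) → M}
    (hk : Manifold.IsSmoothEmbedding 𝓘(ℝ, EuclideanSpace ℝ (Fin n)) (𝓡 n) ∞ k) {Φ :
        OpenPartialHomeomorph M (EuclideanSpace ℝ (Fin n))}
    (hΦt : Φ.target = univ) (hΦc : ContMDiffOn (𝓡 n) (𝓡 n) ∞ Φ Φ.source)
    (hΦ' : ContMDiff (𝓡 n) (𝓡 n) ∞ Φ.symm) (h0 : k 0 ∈ Φ.source) :
    LinearMap.det ((fderiv ℝ (Φ ∘ k) 0 : (EuclideanSpace ℝ (Fin n)) →L[ℝ] (EuclideanSpace ℝ (Fin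
        n))) : (EuclideanSpace ℝ (Fin n)) →ₗ[ℝ] (EuclideanSpace ℝ (Fin n))) ≠ 0 := by
  have hkd : MDifferentiableAt 𝓘(ℝ, EuclideanSpace ℝ (Fin n)) (𝓡 n) k 0 := (hk.contMDiff
      0).mdifferentiableAt (by simp)
  have hΦd : MDifferentiableAt (𝓡 n) (𝓡 n) Φ (k 0) :=
    (hΦc.contMDiffAt (Φ.open_source.mem_nhds h0)).mdifferentiableAt (by simp)
  -- `dk(0)` is invertible
  have hk0 : LinearMap.det (M := EuclideanSpace ℝ (Fin n)) (mfderiv 𝓘(ℝ, EuclideanSpace ℝ (Fin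
      n)) (𝓡 n) k 0).toLinearMap ≠ 0 :=
    det_mfderiv_ne_zero_of_isSmoothEmbedding hk (isOpen_range_of_isSmoothEmbedding_disc hk) 0
  -- `dΦ(k 0)` is invertible
  have hΦ0 : LinearMap.det (M := EuclideanSpace ℝ (Fin n)) (mfderiv (𝓡 n) (𝓡 n) Φ (k
      0)).toLinearMap ≠ 0 := by
    have hid : (Φ : M → EuclideanSpace ℝ (Fin n)) ∘ Φ.symm = id :=
      funext fun y => Φ.right_inv (by rw [hΦt]; trivial)
    have hv : Φ.symm (Φ (k 0)) = k 0 := Φ.left_inv h0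
    have hc := mfderiv_comp (Φ (k 0)) (I := 𝓡 n) (I' := 𝓡 n) (I'' := 𝓡 n) (hv ▸ hΦd)
      ((hΦ' (Φ (k 0))).mdifferentiableAt (by simp))
    rw [hid, mfderiv_id, hv] at hc
    exact left_ne_zero_of_mul_eq_one (det_mul_det_eq_one_of_comp_eq_id (E := EuclideanSpace ℝ
        (Fin n)) hc.symm)
  -- chain rule
  have hchain : mfderiv 𝓘(ℝ, EuclideanSpace ℝ (Fin n)) (𝓡 n) (Φ ∘ k) 0 =
      (mfderiv (𝓡 n) (𝓡 n) Φ (k 0)).comp (mfderiv 𝓘(ℝ, EuclideanSpace ℝ (Fin n)) (𝓡 n) k 0) :=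
    mfderiv_comp 0 hΦd hkd
  have hdet : LinearMap.det (M := EuclideanSpace ℝ (Fin n)) (mfderiv 𝓘(ℝ, EuclideanSpace ℝ (Fin
      n)) (𝓡 n) (Φ ∘ k) 0).toLinearMap =
      LinearMap.det (M := EuclideanSpace ℝ (Fin n)) (mfderiv (𝓡 n) (𝓡 n) Φ (k 0)).toLinearMap *
        LinearMap.det (M := EuclideanSpace ℝ (Fin n)) (mfderiv 𝓘(ℝ, EuclideanSpace ℝ (Fin n)) (𝓡
            n) k 0).toLinearMap := by
    rw [hchain]
    exact LinearMap.det_comp (M := EuclideanSpace ℝ (Fin n)) (mfderiv (𝓡 n) (𝓡 n) Φ (k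
        0)).toLinearMap
      (mfderiv 𝓘(ℝ, EuclideanSpace ℝ (Fin n)) (𝓡 n) k 0).toLinearMap
  have h := mul_ne_zero hΦ0 hk0
  rw [← hdet, mfderiv_eq_fderiv] at h
  exact h

/-! ### The local straightening step (shared by both cases) -/

omit [IsManifold (𝓡 n) ∞ M] in
/-- **Local straightening of a disc onto another with the same centre and positive relative
Jacobian** (Hirsch, *Differential Topology* (1976), Ch. 8 §3, proof of Thm. 3.1, the steps after
the centres have been matched): let `i' = Φ⁻¹` be a disc packaged as a full smooth chart `Φ`, and
`k` a disc with `k 0 = i' 0` whose local map `F = Φ ∘ k` has `det DF(0) > 0`. Then there is a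
compactly supported diffeomorphism `H` of `M` with `H (i' y) = k y` for `‖y‖ ≤ ρ`, some `ρ > 0`:
straighten `DF(0)` by a compactly supported diffeomorphism `s`
(`isStraightenable_of_det_pos`), correct `s⁻¹ ∘ F`, which is tangent to the identity, by a
compactly supported `G` (`exists_diffeomorph_eq_of_fderiv_eq_id`), and transport `s ∘ G` along
`Φ` (`exists_diffeomorph_chartTransport`). This is the tail of the tree's
`exists_diffeomorph_apply_disc_eq_local_cs`, with its input `det DF(0) > 0` made a hypothesis.
[cite: HirschDT1976, Ch. 8 §3, Thm. 3.1] -/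
theorem exists_diffeomorph_apply_disc_eq_local_cs_of_det_pos {k i' : EuclideanSpace ℝ (Fin n) → M}
    (hk : Manifold.IsSmoothEmbedding 𝓘(ℝ, EuclideanSpace ℝ (Fin n)) (𝓡 n) ∞ k) (h0 : k 0 = i' 0)
    {Φ : OpenPartialHomeomorph M (EuclideanSpace ℝ (Fin n))} (hΦt : Φ.target = univ) (hΦs :
        ⇑Φ.symm = i')
    (hΦsrc : Φ.source = range i') (hΦc : ContMDiffOn (𝓡 n) (𝓡 n) ∞ Φ Φ.source)
    (hΦ' : ContMDiff (𝓡 n) (𝓡 n) ∞ Φ.symm)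
    (hpos : 0 < LinearMap.det ((fderiv ℝ (Φ ∘ k) 0 : (EuclideanSpace ℝ (Fin n)) →L[ℝ]
        (EuclideanSpace ℝ (Fin n))) :
      (EuclideanSpace ℝ (Fin n)) →ₗ[ℝ] (EuclideanSpace ℝ (Fin n)))) :
    ∃ H : M ≃ₘ⟮𝓡 n, 𝓡 n⟯ M, Function.HasCompactFixedSupport H ∧
      ∃ ρ > (0 : ℝ), ∀ y : EuclideanSpace ℝ (Fin n), ‖y‖ ≤ ρ → H (i' y) = k y := by
  have h0src : k 0 ∈ Φ.source := by rw [h0, hΦsrc]; exact mem_range_self 0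
  have hΦ0 : Φ (k 0) = 0 := by
    rw [h0, ← hΦs]; exact Φ.right_inv (by rw [hΦt]; trivial)
  -- the local map `F = Φ ∘ k`
  set V : Set (EuclideanSpace ℝ (Fin n)) := k ⁻¹' Φ.source with hV_def
  have hV : IsOpen V := Φ.open_source.preimage hk.contMDiff.continuous
  have h0V : (0 : EuclideanSpace ℝ (Fin n)) ∈ V := h0src
  set F : (EuclideanSpace ℝ (Fin n)) → (EuclideanSpace ℝ (Fin n)) := Φ ∘ k with hF_def
  have hFs : ContMDiffOn (𝓡 n) (𝓡 n) ∞ F V :=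
    hΦc.comp hk.contMDiff.contMDiffOn fun y hy => hy
  have hFc : ContDiffOn ℝ ∞ F V := contMDiffOn_iff_contDiffOn.mp hFs
  have hF0 : F 0 = 0 := hΦ0
  have hFd : DifferentiableAt ℝ F 0 := (hFc.contDiffAt (hV.mem_nhds h0V)).differentiableAt (by simp)
  set L : (EuclideanSpace ℝ (Fin n)) →L[ℝ] (EuclideanSpace ℝ (Fin n)) := fderiv ℝ F 0 with hL_def
  have hL : 0 < LinearMap.det (L : (EuclideanSpace ℝ (Fin n)) →ₗ[ℝ] (EuclideanSpace ℝ (Fin n)))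
      := hpos
  -- straighten `L`
  set Le : (EuclideanSpace ℝ (Fin n)) ≃L[ℝ] (EuclideanSpace ℝ (Fin n)) :=
      L.toContinuousLinearEquivOfDetNeZero hL.ne' with hLe_def
  have hLe : (Le : (EuclideanSpace ℝ (Fin n)) →L[ℝ] (EuclideanSpace ℝ (Fin n))) = L :=
      L.coe_toContinuousLinearEquivOfDetNeZero hL.ne'
  obtain ⟨s, ρ₁, R₁, hρ₁, hs1, hs2⟩ := isStraightenable_of_det_pos Le (by rw [hLe]; exact hL)
  have hs0 : s 0 = 0 := by rw [hs1 0 (by simp [hρ₁.le])]; simp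
  have hs'0 : s.symm 0 = 0 := by
    have h := s.symm_apply_apply 0
    rwa [hs0] at h
  have hsL : HasFDerivAt s L 0 := by
    have hev : (s : EuclideanSpace ℝ (Fin n) → EuclideanSpace ℝ (Fin n)) =ᶠ[𝓝 0] Le := by
      filter_upwards [closedBall_mem_nhds (0 : EuclideanSpace ℝ (Fin n)) hρ₁] with y hy
      exact hs1 y (by simpa using hy)
    rw [← hLe]
    exact (Le : (EuclideanSpace ℝ (Fin n)) →L[ℝ] (EuclideanSpace ℝ (Fin
        n))).hasFDerivAt.congr_of_eventuallyEq hev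
  have hs'd : DifferentiableAt ℝ s.symm 0 := (s.symm.contMDiff.contDiff.differentiable (by simp)) 0
  have hinv : (fderiv ℝ s.symm 0).comp L = ContinuousLinearMap.id ℝ (EuclideanSpace ℝ (Fin n)) := by
    have h1 : HasFDerivAt (s.symm ∘ s) ((fderiv ℝ s.symm 0).comp L) 0 := by
      have h : HasFDerivAt s.symm (fderiv ℝ s.symm 0) (s 0) := by
        rw [hs0]; exact hs'd.hasFDerivAt
      exact h.comp 0 hsL
    have h2 : (s.symm : EuclideanSpace ℝ (Fin n) → EuclideanSpace ℝ (Fin n)) ∘ s = id := funext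
        fun y => s.symm_apply_apply y
    rw [h2] at h1
    exact h1.unique (hasFDerivAt_id 0)
  -- `s⁻¹ ∘ F` is tangent to the identity
  set F₂ : (EuclideanSpace ℝ (Fin n)) → (EuclideanSpace ℝ (Fin n)) := s.symm ∘ F with hF₂_def
  have hF₂c : ContDiffOn ℝ ∞ F₂ V := s.symm.contMDiff.contDiff.comp_contDiffOn hFc
  have hF₂0 : F₂ 0 = 0 := by simp [hF₂_def, hF0, hs'0]
  have hDF₂ : fderiv ℝ F₂ 0 = ContinuousLinearMap.id ℝ (EuclideanSpace ℝ (Fin n)) := by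
    have h : HasFDerivAt s.symm (fderiv ℝ s.symm 0) (F 0) := by
      rw [hF0]; exact hs'd.hasFDerivAt
    have h2 : HasFDerivAt F₂ ((fderiv ℝ s.symm 0).comp L) 0 := h.comp 0 hFd.hasFDerivAt
    rw [h2.fderiv, hinv]
  obtain ⟨r, hr, hrV, G, hG1, hG2⟩ := exists_diffeomorph_eq_of_fderiv_eq_id hV h0V hF₂c hF₂0 hDF₂
  -- `F = s ∘ G` on `B̄(0, r)`
  have hFG : ∀ y : EuclideanSpace ℝ (Fin n), ‖y‖ ≤ r → F y = s (G y) := fun y hy => by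
    rw [hG1 y (by simpa using hy)]
    simp [hF₂_def]
  -- transport `T = s ∘ G` along `Φ`
  set T := G.trans s with hT_def
  have hT : ∀ y : EuclideanSpace ℝ (Fin n), max (2 * r) R₁ ≤ ‖y‖ → T y = y := fun y hy => by
    show s (G y) = y
    rw [hG2 y ((le_max_left _ _).trans hy), hs2 y ((le_max_right _ _).trans hy)]
  obtain ⟨H, hH, hH'⟩ := exists_diffeomorph_chartTransport (φ := Φ) hΦc hΦ' hΦt T hT
  have hHs : Function.HasCompactFixedSupport H :=
    hasCompactFixedSupport_of_eq_self_image_closedBall hΦ'.continuous hH'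
  refine ⟨H, hHs, r, hr, fun y hy => ?_⟩
  have h := hH y
  have e1 : Φ.symm y = i' y := by rw [hΦs]
  rw [e1] at h
  rw [h]
  show Φ.symm (s (G y)) = k y
  rw [← hFG y hy]
  exact Φ.left_inv (hrV (by simp; linarith [hy]))

/-! ### The local unoriented disc theorem, with compact support -/

/-- **Local disc theorem without orientations, compactly supported** (Hirsch, *Differential
Topology* (1976), Ch. 8 §3, Thm. 3.1 and the remark after it; Kosinski, *Differential Manifolds*
(1993), III.(3.6)): for two discs `i, i' : ℝⁿ → M` (smooth embeddings of `ℝⁿ`, `n ≠ 0`) in a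
connected Hausdorff `n`-manifold modelled on `ℝⁿ`, and any linear automorphism `r` of `ℝⁿ` with
`det r < 0`, there is a compactly supported diffeomorphism `f` of `M` and `ρ > 0` such that
either `f (i y) = i' y` for all `‖y‖ ≤ ρ`, or `f (i (r y)) = i' y` for all `‖y‖ ≤ ρ`. Move the
centre `i 0` to `i' 0` by compactly supported homogeneity; the Jacobian of the local map
`Φ ∘ f₁ ∘ i` (`Φ = (i')⁻¹`) is invertible (`det_fderiv_chart_comp_disc_ne_zero`); if it is
positive straighten `f₁ ∘ i`, otherwise `f₁ ∘ i ∘ r`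
(`exists_diffeomorph_apply_disc_eq_local_cs_of_det_pos`). No orientation of `M` is involved.
[cite: HirschDT1976, Ch. 8 §3, Thm. 3.1] -/
theorem exists_diffeomorph_apply_disc_eq_or_reflect_local_cs [ConnectedSpace M]
    {i i' : EuclideanSpace ℝ (Fin n) → M} (hi : Manifold.IsSmoothEmbedding 𝓘(ℝ, EuclideanSpace ℝ
        (Fin n)) (𝓡 n) ∞ i)
    (hi' : Manifold.IsSmoothEmbedding 𝓘(ℝ, EuclideanSpace ℝ (Fin n)) (𝓡 n) ∞ i') (r :
        (EuclideanSpace ℝ (Fin n)) ≃L[ℝ] (EuclideanSpace ℝ (Fin n)))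
    (hr : LinearMap.det (r.toLinearEquiv : (EuclideanSpace ℝ (Fin n)) →ₗ[ℝ] (EuclideanSpace ℝ
        (Fin n))) < 0) :
    ∃ f : M ≃ₘ⟮𝓡 n, 𝓡 n⟯ M, Function.HasCompactFixedSupport f ∧ ∃ ρ > (0 : ℝ),
      (∀ y : EuclideanSpace ℝ (Fin n), ‖y‖ ≤ ρ → f (i y) = i' y) ∨ (∀ y : EuclideanSpace ℝ (Fin
          n), ‖y‖ ≤ ρ → f (i (r y)) = i' y) := by
  -- Step 1: move the centre
  obtain ⟨f₁, hf₁, -, hf₁s⟩ :=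
    exists_diffeomorph_apply_eq_forall_isOrientationPreserving_cs (n := n) (i 0) (i' 0)
  set i₁ : EuclideanSpace ℝ (Fin n) → M := f₁ ∘ i with hi₁_def
  have hi₁ : Manifold.IsSmoothEmbedding 𝓘(ℝ, EuclideanSpace ℝ (Fin n)) (𝓡 n) ∞ i₁ :=
      hi.diffeomorph_comp f₁
  have hi₁0 : i₁ 0 = i' 0 := hf₁
  -- Step 2: the chart `Φ = (i')⁻¹`
  obtain ⟨Φ, hΦt, hΦs, hΦsrc, hΦc⟩ := exists_chart_of_isSmoothEmbedding hi'
  have hΦ' : ContMDiff (𝓡 n) (𝓡 n) ∞ Φ.symm := by rw [hΦs]; exact hi'.contMDiff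
  have h0src : i₁ 0 ∈ Φ.source := by rw [hi₁0, hΦsrc]; exact mem_range_self 0
  -- Step 3: the sign of the Jacobian of `Φ ∘ i₁` at `0`
  have hdet := det_fderiv_chart_comp_disc_ne_zero hi₁ hΦt hΦc hΦ' h0src
  rcases lt_or_gt_of_ne hdet with hneg | hpos
  · -- negative: straighten the reflected disc `i₁ ∘ r`
    set k : EuclideanSpace ℝ (Fin n) → M := i₁ ∘ r with hk_def
    have hk : Manifold.IsSmoothEmbedding 𝓘(ℝ, EuclideanSpace ℝ (Fin n)) (𝓡 n) ∞ k :=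
        hi₁.comp_diffeomorph r.toDiffeomorph
    have hk0 : k 0 = i' 0 := by simp [hk_def, hi₁0]
    have hkpos : 0 < LinearMap.det ((fderiv ℝ (Φ ∘ k) 0 : (EuclideanSpace ℝ (Fin n)) →L[ℝ]
        (EuclideanSpace ℝ (Fin n))) :
        (EuclideanSpace ℝ (Fin n)) →ₗ[ℝ] (EuclideanSpace ℝ (Fin n))) := by
      -- `D(Φ ∘ i₁ ∘ r)(0) = D(Φ ∘ i₁)(0) ∘ r`
      set V : Set (EuclideanSpace ℝ (Fin n)) := i₁ ⁻¹' Φ.source with hV_def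
      have hV : IsOpen V := Φ.open_source.preimage hi₁.contMDiff.continuous
      have h0V : (0 : EuclideanSpace ℝ (Fin n)) ∈ V := h0src
      have hFs : ContMDiffOn (𝓡 n) (𝓡 n) ∞ (Φ ∘ i₁) V :=
        hΦc.comp hi₁.contMDiff.contMDiffOn fun y hy => hy
      have hFc : ContDiffOn ℝ ∞ (Φ ∘ i₁) V := contMDiffOn_iff_contDiffOn.mp hFs
      have hFd : DifferentiableAt ℝ (Φ ∘ i₁) 0 :=
        (hFc.contDiffAt (hV.mem_nhds h0V)).differentiableAt (by simp)
      have h1 : HasFDerivAt (Φ ∘ i₁) (fderiv ℝ (Φ ∘ i₁) 0) (r 0) := by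
        rw [map_zero]; exact hFd.hasFDerivAt
      have h2 : HasFDerivAt (Φ ∘ k) ((fderiv ℝ (Φ ∘ i₁) 0).comp (r : (EuclideanSpace ℝ (Fin n))
          →L[ℝ] (EuclideanSpace ℝ (Fin n)))) 0 :=
        h1.comp 0 (r : (EuclideanSpace ℝ (Fin n)) →L[ℝ] (EuclideanSpace ℝ (Fin n))).hasFDerivAt
      have hcomp : (((fderiv ℝ (Φ ∘ i₁) 0).comp (r : (EuclideanSpace ℝ (Fin n)) →L[ℝ]
          (EuclideanSpace ℝ (Fin n))) :
          (EuclideanSpace ℝ (Fin n)) →L[ℝ] (EuclideanSpace ℝ (Fin n))) : (EuclideanSpace ℝ (Fin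
              n)) →ₗ[ℝ] (EuclideanSpace ℝ (Fin n))) =
          ((fderiv ℝ (Φ ∘ i₁) 0 : (EuclideanSpace ℝ (Fin n)) →L[ℝ] (EuclideanSpace ℝ (Fin n))) :
              (EuclideanSpace ℝ (Fin n)) →ₗ[ℝ] (EuclideanSpace ℝ (Fin n))).comp
            ((r : (EuclideanSpace ℝ (Fin n)) →L[ℝ] (EuclideanSpace ℝ (Fin n))) : (EuclideanSpace
                ℝ (Fin n)) →ₗ[ℝ] (EuclideanSpace ℝ (Fin n))) := rfl
      rw [h2.fderiv, hcomp, LinearMap.det_comp]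
      exact mul_pos_of_neg_of_neg hneg hr
    obtain ⟨H, hHs, ρ, hρ, hH⟩ := exists_diffeomorph_apply_disc_eq_local_cs_of_det_pos hk hk0
      hΦt hΦs hΦsrc hΦc hΦ' hkpos
    refine ⟨f₁.trans H.symm, (Function.HasCompactFixedSupport.symm (f := H.toEquiv) hHs).comp hf₁s,
      ρ, hρ, Or.inr fun y hy => ?_⟩
    show H.symm (f₁ (i (r y))) = i' y
    rw [show f₁ (i (r y)) = k y from rfl, ← hH y hy, H.symm_apply_apply]
  · -- positive: straighten `i₁` itself
    obtain ⟨H, hHs, ρ, hρ, hH⟩ := exists_diffeomorph_apply_disc_eq_local_cs_of_det_pos hi₁ hi₁0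
      hΦt hΦs hΦsrc hΦc hΦ' hpos
    refine ⟨f₁.trans H.symm, (Function.HasCompactFixedSupport.symm (f := H.toEquiv) hHs).comp hf₁s,
      ρ, hρ, Or.inl fun y hy => ?_⟩
    show H.symm (f₁ (i y)) = i' y
    rw [show f₁ (i y) = i₁ y from rfl, ← hH y hy, H.symm_apply_apply]

/-! ### The unoriented disc theorem, with compact support -/

/-- **Disc theorem without orientations, compactly supported** (R. Palais, *Extending
diffeomorphisms* (1960), Thm. B; Hirsch, *Differential Topology* (1976), Ch. 8 §3, Thm. 3.1 with
the remark following it; Kosinski, *Differential Manifolds* (1993), III.(3.6): in a connected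
manifold two embedded discs are ambient isotopic up to precomposition with a reflection): for two
discs `i, i' : ℝⁿ → M` (`n ≠ 0`) in a connected Hausdorff smooth `n`-manifold modelled on `ℝⁿ`
and any linear automorphism `r` of `ℝⁿ` with `det r < 0`, there is a diffeomorphism `f` of `M`
WITH COMPACT (FIXED) SUPPORT such that either `f (i y) = i' y` for all `‖y‖ ≤ 1`, or
`f (i (r y)) = i' y` for all `‖y‖ ≤ 1`. From the local theorem
(`exists_diffeomorph_apply_disc_eq_or_reflect_local_cs`) by compactly supported ambient
contractions of the discs `i` (or `i ∘ r`) and `i'`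
(`exists_diffeomorph_apply_disc_eq_disc_smul_cs`). No orientation of `M` is involved; for
orientable `M` and a reflection `r` the first case occurs exactly when `i`, `i'` have the same
orientation character, but this is not needed here.
[cite: Palais1960, Thm. B] [cite: HirschDT1976, Ch. 8 §3, Thm. 3.1] -/
theorem exists_diffeomorph_apply_disc_eq_or_reflect_cs [ConnectedSpace M] (hn : n ≠ 0)
    {i i' : EuclideanSpace ℝ (Fin n) → M} (hi : Manifold.IsSmoothEmbedding 𝓘(ℝ, EuclideanSpace ℝ
        (Fin n)) (𝓡 n) ∞ i)
    (hi' : Manifold.IsSmoothEmbedding 𝓘(ℝ, EuclideanSpace ℝ (Fin n)) (𝓡 n) ∞ i') (r :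
        (EuclideanSpace ℝ (Fin n)) ≃L[ℝ] (EuclideanSpace ℝ (Fin n)))
    (hr : LinearMap.det (r.toLinearEquiv : (EuclideanSpace ℝ (Fin n)) →ₗ[ℝ] (EuclideanSpace ℝ
        (Fin n))) < 0) :
    ∃ f : M ≃ₘ⟮𝓡 n, 𝓡 n⟯ M, Function.HasCompactFixedSupport f ∧
      ((∀ y : EuclideanSpace ℝ (Fin n), ‖y‖ ≤ 1 → f (i y) = i' y) ∨ (∀ y : EuclideanSpace ℝ (Fin
          n), ‖y‖ ≤ 1 → f (i (r y)) = i' y)) := by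
  obtain ⟨f₀, hf₀s, ρ, hρ, hf₀⟩ := exists_diffeomorph_apply_disc_eq_or_reflect_local_cs hi hi' r hr
  set ρ' := min ρ 1 with hρ'_def
  have hρ' : 0 < ρ' := lt_min hρ one_pos
  have hρ'1 : ρ' ≤ 1 := min_le_right _ _
  have hρ'ρ : ρ' ≤ ρ := min_le_left _ _
  have hρy : ∀ y : EuclideanSpace ℝ (Fin n), ‖y‖ ≤ 1 → ‖ρ' • y‖ ≤ ρ := fun y hy => by
    rw [norm_smul, Real.norm_of_nonneg hρ'.le]
    calc ρ' * ‖y‖ ≤ ρ' * 1 := by gcongr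
      _ ≤ ρ := by rw [mul_one]; exact hρ'ρ
  obtain ⟨K', -, hK's, hK'⟩ := exists_diffeomorph_apply_disc_eq_disc_smul_cs hn hi' hρ'
  rcases hf₀ with h | h
  · obtain ⟨K, -, hKs, hK⟩ := exists_diffeomorph_apply_disc_eq_disc_smul_cs hn hi hρ'
    refine ⟨K.trans (f₀.trans K'.symm),
      ((Function.HasCompactFixedSupport.symm (f := K'.toEquiv) hK's).comp hf₀s).comp hKs,
      Or.inl fun y hy => ?_⟩
    show K'.symm (f₀ (K (i y))) = i' y
    rw [hK y hy, h _ (hρy y hy), ← hK' y hy, K'.symm_apply_apply]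
  · have hir : Manifold.IsSmoothEmbedding 𝓘(ℝ, EuclideanSpace ℝ (Fin n)) (𝓡 n) ∞ (i ∘ r) :=
      hi.comp_diffeomorph r.toDiffeomorph
    obtain ⟨K, -, hKs, hK⟩ := exists_diffeomorph_apply_disc_eq_disc_smul_cs hn hir hρ'
    refine ⟨K.trans (f₀.trans K'.symm),
      ((Function.HasCompactFixedSupport.symm (f := K'.toEquiv) hK's).comp hf₀s).comp hKs,
      Or.inr fun y hy => ?_⟩
    show K'.symm (f₀ (K (i (r y)))) = i' y
    have e1 : K (i (r y)) = i (r (ρ' • y)) := hK y hy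
    rw [e1, h _ (hρy y hy), ← hK' y hy, K'.symm_apply_apply]

end Euclidean

/-! ### Arbitrary models with corners -/

section Corners

variable {E : Type*} [NormedAddCommGroup E] [NormedSpace ℝ E] [FiniteDimensional ℝ E]
  {H : Type*} [TopologicalSpace H] {I : ModelWithCorners ℝ E H}
  {M : Type*} [TopologicalSpace M] [T2Space M] [ChartedSpace H M] [IsManifold I ∞ M]

/-- **Disc theorem without orientations, arbitrary model with corners** (R. Palais, *Extending
diffeomorphisms* (1960), Thm. B; Hirsch, *Differential Topology* (1976), Ch. 8 §3, Thm. 3.1 with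
the remark following it; the form used in Kosinski, *Differential Manifolds* (1993), VI.(1.1) for
connected sums of possibly non-orientable manifolds with boundary, discs in `Int M`, III.(3.6)):
in a connected Hausdorff `C^∞` manifold `M` modelled on any real model with corners over a
finite-dimensional normed space `E ≠ 0`, for two discs `i, i' : E → M` (smooth embeddings of the
model vector space) and any linear automorphism `r` of `E` with `det r < 0` there is a
diffeomorphism `f` of `M` with either `f (i y) = i' y` for all `‖y‖ ≤ 1` or `f (i (r y)) = i' y`
for all `‖y‖ ≤ 1`. Proof: interior manifold, recharting on `ℝⁿ` along a norm-non-increasing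
`L`, the compactly supported unoriented disc theorem for the reflection `L ∘ r ∘ L⁻¹`
(`exists_diffeomorph_apply_disc_eq_or_reflect_cs`), extension by the identity (module
docstring). No orientation or orientability hypothesis.
[cite: Palais1960, Thm. B] [cite: HirschDT1976, Ch. 8 §3, Thm. 3.1] -/
theorem exists_diffeomorph_apply_disc_eq_or_reflect_of_model [ConnectedSpace M]
    (hE : finrank ℝ E ≠ 0) {i i' : E → M} (hi : Manifold.IsSmoothEmbedding 𝓘(ℝ, E) I ∞ i)
    (hi' : Manifold.IsSmoothEmbedding 𝓘(ℝ, E) I ∞ i') (r : E ≃L[ℝ] E)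
    (hr : LinearMap.det (r.toLinearEquiv : E →ₗ[ℝ] E) < 0) :
    ∃ f : M ≃ₘ⟮I, I⟯ M,
      (∀ y : E, ‖y‖ ≤ 1 → f (i y) = i' y) ∨ (∀ y : E, ‖y‖ ≤ 1 → f (i (r y)) = i' y) := by
  -- Step 1: the interior manifold and the lifted discs
  have hint := isInteriorPoint_of_isSmoothEmbedding_disc hi
  have hint' := isInteriorPoint_of_isSmoothEmbedding_disc hi'
  have hî : Manifold.IsSmoothEmbedding 𝓘(ℝ, E) 𝓘(ℝ, E) ∞ (InteriorManifold.lift i hint) :=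
    InteriorManifold.isSmoothEmbedding_lift_disc hi
  have hî' : Manifold.IsSmoothEmbedding 𝓘(ℝ, E) 𝓘(ℝ, E) ∞ (InteriorManifold.lift i' hint') :=
    InteriorManifold.isSmoothEmbedding_lift_disc hi'
  -- Step 2: rechart on `ℝⁿ` along a norm-nonincreasing linear isomorphism
  let L : E ≃L[ℝ] EuclideanSpace ℝ (Fin (finrank ℝ E)) :=
    ContinuousLinearEquiv.shrink (ContinuousLinearEquiv.ofFinrankEq (by simp))
  have hL1 : ∀ y : E, ‖L y‖ ≤ ‖y‖ := fun y => ContinuousLinearEquiv.norm_shrink_le _ y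
  have hjE : Manifold.IsSmoothEmbedding 𝓘(ℝ, EuclideanSpace ℝ (Fin (finrank ℝ E)))
      (𝓡 (finrank ℝ E)) ∞
      (Recharted.of L ∘ InteriorManifold.lift i hint ∘ (L.symm : _ → E) :
        _ → Recharted (InteriorManifold I M) L) :=
    Recharted.isSmoothEmbedding_disc L hî
  have hjE' : Manifold.IsSmoothEmbedding 𝓘(ℝ, EuclideanSpace ℝ (Fin (finrank ℝ E)))
      (𝓡 (finrank ℝ E)) ∞
      (Recharted.of L ∘ InteriorManifold.lift i' hint' ∘ (L.symm : _ → E) :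
        _ → Recharted (InteriorManifold I M) L) :=
    Recharted.isSmoothEmbedding_disc L hî'
  -- the conjugated reflection `r₁ = L ∘ r ∘ L⁻¹` of `ℝⁿ`
  let r₁ : EuclideanSpace ℝ (Fin (finrank ℝ E)) ≃L[ℝ] EuclideanSpace ℝ (Fin (finrank ℝ E)) :=
    L.symm.trans (r.trans L)
  have hr₁ : LinearMap.det (r₁.toLinearEquiv : EuclideanSpace ℝ (Fin (finrank ℝ E)) →ₗ[ℝ]
      EuclideanSpace ℝ (Fin (finrank ℝ E))) < 0 := by
    have : (r₁.toLinearEquiv : EuclideanSpace ℝ (Fin (finrank ℝ E)) →ₗ[ℝ]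
        EuclideanSpace ℝ (Fin (finrank ℝ E))) =
        (L.toLinearEquiv : E →ₗ[ℝ] _) ∘ₗ (r.toLinearEquiv : E →ₗ[ℝ] E) ∘ₗ
          (L.toLinearEquiv.symm : _ →ₗ[ℝ] E) := by
      ext v; rfl
    rw [this, LinearMap.det_conj]
    exact hr
  have hr₁L : ∀ y : E, r₁ (L y) = L (r y) := fun y => by
    simp [r₁]
  -- Step 3: the compactly supported unoriented disc theorem on `Recharted X L`
  obtain ⟨g, hgs, hg⟩ := exists_diffeomorph_apply_disc_eq_or_reflect_cs hE hjE hjE' r₁ hr₁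
  obtain ⟨K, hK, hgK⟩ := exists_isCompact_forall_eq_self_of_hasCompactFixedSupport hgs
  -- Step 4: read back on `X` and extend by the identity to `M`
  let g' : InteriorManifold I M ≃ₘ⟮𝓘(ℝ, E), 𝓘(ℝ, E)⟯ InteriorManifold I M :=
    (Recharted.diffeomorph L).trans (g.trans (Recharted.diffeomorph L).symm)
  have hg'c : ∀ x : InteriorManifold I M, g' x = (Recharted.of L).symm (g (Recharted.of L x)) :=
    fun x => rfl
  have hK' : IsCompact ((Recharted.of L).symm '' K) :=
    hK.image (Recharted.contMDiff_of_symm L).continuous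
  have hg'K : ∀ x ∉ (Recharted.of L).symm '' K, g' x = x := fun x hx => by
    have hx' : Recharted.of L x ∉ K := fun h => hx ⟨_, h, rfl⟩
    rw [hg'c, hgK _ hx']
    rfl
  obtain ⟨F, hF, -⟩ := InteriorManifold.exists_diffeomorph_extend g' hK' hg'K
  refine ⟨F, ?_⟩
  have h1 : ∀ y, i y = (InteriorManifold.lift i hint y).val := fun y => rfl
  have h2 : ∀ y, i' y = (InteriorManifold.lift i' hint' y).val := fun y => rfl
  have h3 : ∀ y, Recharted.of L (InteriorManifold.lift i hint y) =
      (Recharted.of L ∘ InteriorManifold.lift i hint ∘ (L.symm : _ → E)) (L y) := fun y => by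
    simp
  rcases hg with hg | hg
  · refine Or.inl fun y hy => ?_
    rw [h1, hF, hg'c, h2]
    congr 1
    rw [h3, hg (L y) ((hL1 y).trans hy)]
    simp
  · refine Or.inr fun y hy => ?_
    rw [h1, hF, hg'c, h2]
    congr 1
    rw [h3, ← hr₁L, hg (L y) ((hL1 y).trans hy)]
    simp

end Corners

end Literature.Topology.FourManifolds
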